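import Literature.NumberTheory.Automorphic.SLTwoTreeProjectiveActionIso            -- ★ B-p08 (g28): `glVertexAct`, `glVertexAct_eq_iff/_one/_mul/_scalar_mul`, `glTreeIso`
import Literature.NumberTheory.Automorphic.UnitarySplitTorusSelfDualVertex         -- ★ `mem_glInt_of_coe_eq_companion`
import Literature.Combinatorics.SimpleGraph.TreeAutomorphismFiniteInvariantFacet    -- ★ (this seat): `exists_fixed_or_swap_adj_of_sq_apply_eq`
import HarnessLib

/-!
# A bounded element of `PGL₂(F)` fixes a vertex or inverts an edge of the tree of `SL₂(F)` (Serre, *Trees* II.1.3; Tits 1979 §3.2)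

Topic `NumberTheory/Automorphic`; namespace `Literature.NumberTheory.Automorphic.HermitianLatticeTree`.  KERNEL mathematics only: theorems, no definition, no
`sorry`.  Cell `pub/hodgecm-mathlib`, F0∕P3a, crux H413 = `stmt-HodgeConjecture-24833`, road W′ = «R1LL-WILD» (LEAD T9-25 (b); architect A-p16 (g28)), socket
«I-5a-ram-WILD» (census 822e2006 §1 (B) row 3; `CENSUS-END-WILD.F0P3a-p04g14.md` §3 (a)); seat F0P3a-p04 (g14).  HONEST LABEL: HC_CM is proved only modulo the printed
citations until rung 0 closes; nothing printed is asserted here.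

THE MATHEMATICS.  `F` discretely valued, `ϖ` a uniformiser, `X` the tree of `SL₂(F)` (★ `latticeTree (RingHom.id F) ϖ J`), `g · M := glVertexAct hϖ g M` (★ B-p08).
* §1 `2 × 2` Cayley–Hamilton in frame form: the cyclic frame `A = [e | he]` satisfies `h A = A C`, `C = (0 −det h; 1 tr h)` (`mul_cyclicFrame_eq_cyclicFrame_mul_companion`),
  and every non-scalar `h` has a cyclic vector (`exists_det_cyclicFrame_ne_zero`); the trace identity `tr h² = (tr h)² − 2 det h` is ★ `trace_mul_self_fin_two` (inlined).
* §2 `exists_glVertexAct_eq_self_of_valuation_trace_le_one`: `|tr h| ≤ 1`, `|det h| = 1` ⟹ `h` fixes a vertex (the special representative of the class of the cyclic lattice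
  `𝒪e ⊕ 𝒪he = latt A`, since `A⁻¹ h A = C ∈ GL₂(𝒪)` by ★ `mem_glInt_of_coe_eq_companion`; a scalar acts trivially, ★ `glVertexAct_scalar_mul`);
  `exists_glVertexAct_eq_self_of_valuation_det_eq_zpow`: `|tr h|² ≤ |det h| = |ϖ|^{2k}` ⟹ the same for `ϖ^{−k} h`;
  **`exists_glVertexAct_eq_self_or_swap_of_valuation_trace_sq_le`: `|tr h|² ≤ |det h|` (`[h]` BOUNDED in `PGL₂(F)`) ⟹ `[h]` fixes a vertex or inverts an edge** —
  `[h²]` has even `v(det)` and is bounded, so fixes some `M`; then `{M, [h]M}` is a finite invariant set and ★ `RootedTree.exists_fixed_or_swap_adj_of_sq_apply_eq`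
  (Serre I.6.5 with inversions) applies.
NOT here: unitary groups (the `U_w`-dress is ★ `UnitaryTwoRamifiedBoundedElementLevels`).

## References
* [Serre1980Trees] J.-P. Serre, *Trees* (1980), Ch. II §1.2–§1.3, Ch. I §6.5.
* [Tits1979] J. Tits, *Reductive groups over local fields*, PSPM 33.1 (1979), §3.2 (bounded subgroups fix a point).
-/

set_option autoImplicit false

noncomputable section

open scoped ValuativeRel Matrix MatrixGroups
open Matrix ValuativeRel

namespace Literature.NumberTheory.Automorphic.HermitianLatticeTree

open Literature.NumberTheory.Automorphic Literature.NumberTheory.Automorphic.UnitaryGroup Literature.Combinatorics.SimpleGraph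

variable {F : Type*} [Field F] [ValuativeRel F] {ϖ : F} (hϖ : IsUniformizingElement ϖ)

/-! ## §1 Cayley–Hamilton for `2 × 2` matrices: the cyclic lattice `𝒪 e ⊕ 𝒪 he` -/

omit [ValuativeRel F] in
/-- **The cyclic frame**: for `h` and a vector `e`, the matrix `A = [e | he]` satisfies `h · A = A · C` with `C = (0 −det h; 1 tr h)` the companion matrix (Cayley–Hamilton).
[cite: Serre1980Trees, Ch. II §1.2] -/
theorem mul_cyclicFrame_eq_cyclicFrame_mul_companion (h : Matrix (Fin 2) (Fin 2) F) (e : Fin 2 → F) :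
    h * !![e 0, (h *ᵥ e) 0; e 1, (h *ᵥ e) 1] = !![e 0, (h *ᵥ e) 0; e 1, (h *ᵥ e) 1] * !![0, -h.det; 1, h.trace] := by
  ext i j
  rw [Matrix.trace_fin_two, Matrix.det_fin_two]
  fin_cases i <;> fin_cases j <;> simp [Matrix.mul_apply, Matrix.mulVec, dotProduct, Fin.sum_univ_two] <;> ring

omit [ValuativeRel F] in
/-- **A non-scalar `2 × 2` matrix has a cyclic vector**: some `e` with `det [e | he] ≠ 0`. [cite: Serre1980Trees, Ch. II §1.2] -/
theorem exists_det_cyclicFrame_ne_zero (h : Matrix (Fin 2) (Fin 2) F) (hns : ¬ ∃ c : F, h = c • (1 : Matrix (Fin 2) (Fin 2) F)) :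
    ∃ e : Fin 2 → F, (!![e 0, (h *ᵥ e) 0; e 1, (h *ᵥ e) 1]).det ≠ 0 := by
  by_cases h10 : h 1 0 ≠ 0
  · refine ⟨![1, 0], ?_⟩
    rw [Matrix.det_fin_two]
    simpa [Matrix.mulVec, dotProduct, Fin.sum_univ_two] using h10
  by_cases h01 : h 0 1 ≠ 0
  · refine ⟨![0, 1], ?_⟩
    rw [Matrix.det_fin_two]
    simpa [Matrix.mulVec, dotProduct, Fin.sum_univ_two] using h01
  rw [not_not] at h10 h01
  by_cases hdiag : h 0 0 = h 1 1
  · exfalso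
    apply hns
    refine ⟨h 0 0, ?_⟩
    ext i j
    fin_cases i <;> fin_cases j <;> simp [h10, h01, hdiag]
  · refine ⟨![1, 1], ?_⟩
    rw [Matrix.det_fin_two]
    simp [Matrix.mulVec, dotProduct, Fin.sum_univ_two, h10, h01]
    exact fun h' => hdiag (by linear_combination -h')

/-! ## §2 A bounded element of `PGL₂(F)` fixes a vertex or inverts an edge of the tree of `SL₂(F)` -/

variable [IsDiscreteValuationRing 𝒪[F]]

include hϖ in
/-- **An element of `GL₂(F)` with integral trace and unit determinant fixes a vertex of the tree** (it stabilises the cyclic lattice `𝒪e ⊕ 𝒪he`, whose frame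
conjugates it to the integral companion matrix; a scalar acts trivially). [cite: Serre1980Trees, Ch. II §1.2–§1.3] [cite: Tits1979, §3.2] -/
theorem exists_glVertexAct_eq_self_of_valuation_trace_le_one (h : GL (Fin 2) F) (htr : valuation F (h : Matrix (Fin 2) (Fin 2) F).trace ≤ 1)
    (hdet : valuation F (h : Matrix (Fin 2) (Fin 2) F).det = 1) :
    ∃ M : {M : Submodule 𝒪[F] (Fin 2 → F) // IsSpecialLattice (RingHom.id F) ϖ !![(0 : F), 1; -1, 0] M}, glVertexAct hϖ h M = M := by
  by_cases hns : ∃ c : F, (h : Matrix (Fin 2) (Fin 2) F) = c • (1 : Matrix (Fin 2) (Fin 2) F)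
  · -- scalar: acts trivially
    obtain ⟨c, hc⟩ := hns
    have hc0 : c ≠ 0 := by
      intro h0
      apply (h.isUnit.map Matrix.detMonoidHom).ne_zero
      show (h : Matrix (Fin 2) (Fin 2) F).det = 0
      rw [hc, h0, zero_smul, det_zero]
    obtain ⟨k, hk⟩ := exists_zpow_isSpecialLattice hϖ (1 : GL (Fin 2) F)
    refine ⟨⟨_, hk⟩, ?_⟩
    have hh : h = (Units.mk0 c hc0).map ((Matrix.scalar (Fin 2) : F →+* Matrix (Fin 2) (Fin 2) F) : F →* Matrix (Fin 2) (Fin 2) F) * 1 := by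
      apply Units.ext
      rw [mul_one, Units.coe_map, hc]
      simp [Matrix.scalar_apply, Matrix.smul_one_eq_diagonal]
    rw [hh, glVertexAct_scalar_mul, glVertexAct_one]
  · -- non-scalar: the cyclic frame `A = [e | he]`, `h A = A C`, `C ∈ GL₂(𝒪)`
    obtain ⟨e, hA⟩ := exists_det_cyclicFrame_ne_zero (h : Matrix (Fin 2) (Fin 2) F) hns
    set A : GL (Fin 2) F := Matrix.GeneralLinearGroup.mkOfDetNeZero _ hA with hAdef
    have hCdet : (!![(0 : F), -(h : Matrix (Fin 2) (Fin 2) F).det; 1, (h : Matrix (Fin 2) (Fin 2) F).trace]).det ≠ 0 := by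
      rw [Matrix.det_fin_two]; simpa using (h.isUnit.map Matrix.detMonoidHom).ne_zero
    set C : GL (Fin 2) F := Matrix.GeneralLinearGroup.mkOfDetNeZero _ hCdet with hCdef
    have hC : C ∈ glInt 2 F := mem_glInt_of_coe_eq_companion (by rw [hCdef, Matrix.GeneralLinearGroup.val_mkOfDetNeZero]) ((Valuation.mem_integer_iff _ _).2 htr) hdet
    have hmul : h * A = A * C := by
      apply Units.ext
      rw [Units.val_mul, Units.val_mul, hAdef, hCdef, Matrix.GeneralLinearGroup.val_mkOfDetNeZero, Matrix.GeneralLinearGroup.val_mkOfDetNeZero]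
      exact mul_cyclicFrame_eq_cyclicFrame_mul_companion _ e
    obtain ⟨k, hk⟩ := exists_zpow_isSpecialLattice hϖ A
    refine ⟨⟨_, hk⟩, (glVertexAct_eq_iff hϖ h _ _).2 ⟨0, ?_⟩⟩
    show scaleLattice (ϖ ^ k) (latt (A : Matrix (Fin 2) (Fin 2) F)) = scaleLattice (ϖ ^ (0 : ℤ)) (mapGL h (scaleLattice (ϖ ^ k) (latt (A : Matrix (Fin 2) (Fin 2) F))))
    rw [zpow_zero, scaleLattice_one, mapGL_scaleLattice, mapGL_latt, hmul, latt_mul_of_mem_glInt A C hC]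

include hϖ in
/-- **A bounded element whose determinant has EVEN valuation fixes a vertex**: `|tr h|² ≤ |det h| = |ϖ|^{2k}` ⟹ `ϖ^{−k} h` has integral trace and unit determinant,
and homotheties act trivially. [cite: Serre1980Trees, Ch. II §1.2–§1.3] [cite: Tits1979, §3.2] -/
theorem exists_glVertexAct_eq_self_of_valuation_det_eq_zpow (h : GL (Fin 2) F)
    (htr : valuation F (h : Matrix (Fin 2) (Fin 2) F).trace ^ 2 ≤ valuation F (h : Matrix (Fin 2) (Fin 2) F).det) {k : ℤ}
    (hdet : valuation F (h : Matrix (Fin 2) (Fin 2) F).det = valuation F (ϖ ^ (2 * k))) :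
    ∃ M : {M : Submodule 𝒪[F] (Fin 2 → F) // IsSpecialLattice (RingHom.id F) ϖ !![(0 : F), 1; -1, 0] M}, glVertexAct hϖ h M = M := by
  have h0 := hϖ.ne_zero
  have hv0 : valuation F ϖ ≠ 0 := (Valuation.ne_zero_iff _).2 h0
  -- `h' := ϖ^{−k} h`
  set c : Fˣ := Units.mk0 (ϖ ^ (-k)) (zpow_ne_zero _ h0) with hcdef
  set h' : GL (Fin 2) F := c.map ((Matrix.scalar (Fin 2) : F →+* Matrix (Fin 2) (Fin 2) F) : F →* Matrix (Fin 2) (Fin 2) F) * h with hh'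
  have hcoe : (h' : Matrix (Fin 2) (Fin 2) F) = ϖ ^ (-k) • (h : Matrix (Fin 2) (Fin 2) F) := by
    rw [hh', Units.val_mul, Units.coe_map, Matrix.smul_eq_diagonal_mul]; simp [Matrix.scalar_apply, hcdef]
  have hdet' : valuation F (h' : Matrix (Fin 2) (Fin 2) F).det = 1 := by
    rw [hcoe, Matrix.det_smul, Fintype.card_fin, map_mul, map_pow, hdet, ← map_pow, ← map_mul, ← zpow_natCast, ← _root_.zpow_mul, ← zpow_add₀ h0,
      show (-k * ((2 : ℕ) : ℤ) + 2 * k : ℤ) = 0 by push_cast; ring, zpow_zero, map_one]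
  have htr' : valuation F (h' : Matrix (Fin 2) (Fin 2) F).trace ≤ 1 := by
    have hsq : valuation F (h' : Matrix (Fin 2) (Fin 2) F).trace ^ 2 ≤ 1 := by
      rw [hcoe, Matrix.trace_smul, smul_eq_mul, map_mul, mul_pow, ← map_pow, ← zpow_natCast, ← _root_.zpow_mul]
      calc valuation F (ϖ ^ (-k * (2 : ℕ))) * valuation F (h : Matrix (Fin 2) (Fin 2) F).trace ^ 2
          ≤ valuation F (ϖ ^ (-k * (2 : ℕ))) * valuation F (h : Matrix (Fin 2) (Fin 2) F).det := mul_le_mul' le_rfl htr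
        _ = 1 := by
          rw [hdet, ← map_mul, ← zpow_add₀ h0, show (-k * ((2 : ℕ) : ℤ) + 2 * k : ℤ) = 0 by push_cast; ring, zpow_zero, map_one]
    exact (pow_le_one_iff_of_nonneg zero_le two_ne_zero).1 hsq
  obtain ⟨M, hM⟩ := exists_glVertexAct_eq_self_of_valuation_trace_le_one hϖ h' htr' hdet'
  refine ⟨M, ?_⟩
  rw [hh', glVertexAct_scalar_mul] at hM
  exact hM

include hϖ in
/-- **A BOUNDED ELEMENT OF `PGL₂(F)` FIXES A VERTEX OR INVERTS AN EDGE of the tree of `SL₂(F)`**: if `|tr h|² ≤ |det h|` (i.e. `[h]` lies in a compact subgroup of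
`PGL₂(F)`), then `[h]²` has a determinant of even valuation and is still bounded (`tr h² = (tr h)² − 2 det h`), hence fixes a vertex `M`; so `{M, [h]M}` is a finite
invariant set and ★ `exists_fixed_or_swap_adj_of_sq_apply_eq` applies.  (When `v(det h)` is odd `[h]` swaps the two vertex types, so it is the edge case.)
[cite: Serre1980Trees, Ch. II §1.3 and I.6.5] [cite: Tits1979, §3.2] -/
theorem exists_glVertexAct_eq_self_or_swap_of_valuation_trace_sq_le (h : GL (Fin 2) F)
    (htr : valuation F (h : Matrix (Fin 2) (Fin 2) F).trace ^ 2 ≤ valuation F (h : Matrix (Fin 2) (Fin 2) F).det) :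
    (∃ M : {M : Submodule 𝒪[F] (Fin 2 → F) // IsSpecialLattice (RingHom.id F) ϖ !![(0 : F), 1; -1, 0] M}, glVertexAct hϖ h M = M) ∨
      ∃ M N : {M : Submodule 𝒪[F] (Fin 2 → F) // IsSpecialLattice (RingHom.id F) ϖ !![(0 : F), 1; -1, 0] M},
        (latticeTree (RingHom.id F) ϖ !![(0 : F), 1; -1, 0]).Adj M N ∧ glVertexAct hϖ h M = N ∧ glVertexAct hϖ h N = M := by
  have h0 := hϖ.ne_zero
  have hdet0 : (h : Matrix (Fin 2) (Fin 2) F).det ≠ 0 := (h.isUnit.map Matrix.detMonoidHom).ne_zero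
  -- `det h = ϖ^a · unit`
  obtain ⟨a, u, hu, hau⟩ := exists_eq_zpow_mul_of_ne_zero hϖ hdet0
  have hvdet : valuation F (h : Matrix (Fin 2) (Fin 2) F).det = valuation F (ϖ ^ a) := by rw [hau, map_mul, hu, mul_one]
  -- `h²` is bounded with `det` of even valuation
  have hsq_det : valuation F ((h * h : GL (Fin 2) F) : Matrix (Fin 2) (Fin 2) F).det = valuation F (ϖ ^ (2 * a)) := by
    rw [Units.val_mul, Matrix.det_mul, map_mul, hvdet, ← map_mul, ← zpow_add₀ h0, two_mul]
  have h2 : valuation F (2 : F) ≤ 1 := by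
    have : ((2 : 𝒪[F]) : F) = 2 := by norm_cast
    rw [← this]; exact (Valuation.mem_integer_iff _ _).1 (2 : 𝒪[F]).2
  have hsq_tr : valuation F ((h * h : GL (Fin 2) F) : Matrix (Fin 2) (Fin 2) F).trace ^ 2 ≤ valuation F ((h * h : GL (Fin 2) F) : Matrix (Fin 2) (Fin 2) F).det := by
    -- `tr(h²) = (tr h)² − 2 det h` (the `2 × 2` trace identity, cf. ★ `trace_mul_self_fin_two`)
    have htr2 : ((h : Matrix (Fin 2) (Fin 2) F) * (h : Matrix (Fin 2) (Fin 2) F)).trace =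
        (h : Matrix (Fin 2) (Fin 2) F).trace ^ 2 - 2 * (h : Matrix (Fin 2) (Fin 2) F).det := by
      rw [Matrix.trace_fin_two, Matrix.trace_fin_two, Matrix.det_fin_two]
      simp [Matrix.mul_apply, Fin.sum_univ_two]
      ring
    rw [Units.val_mul, htr2, Matrix.det_mul, map_mul]
    have hle : valuation F ((h : Matrix (Fin 2) (Fin 2) F).trace ^ 2 - 2 * (h : Matrix (Fin 2) (Fin 2) F).det) ≤ valuation F (h : Matrix (Fin 2) (Fin 2) F).det := by
      refine le_trans (Valuation.map_sub _ _ _) (max_le ?_ ?_)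
      · rwa [map_pow]
      · rw [map_mul]; exact mul_le_of_le_one_left' h2
    calc valuation F ((h : Matrix (Fin 2) (Fin 2) F).trace ^ 2 - 2 * (h : Matrix (Fin 2) (Fin 2) F).det) ^ 2
        ≤ valuation F (h : Matrix (Fin 2) (Fin 2) F).det ^ 2 := pow_le_pow_left' hle 2
      _ = _ := sq _
  obtain ⟨M, hM⟩ := exists_glVertexAct_eq_self_of_valuation_det_eq_zpow hϖ (h * h) hsq_tr hsq_det
  rw [glVertexAct_mul] at hM
  -- the tree lemma on `α = glTreeIso h`
  have hres := RootedTree.exists_fixed_or_swap_adj_of_sq_apply_eq (isTree_latticeTree_id_altJ hϖ) (glTreeIso hϖ h) (M := M)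
    (by rw [glTreeIso_apply, glTreeIso_apply]; exact hM)
  simpa only [glTreeIso_apply] using hres

end Literature.NumberTheory.Automorphic.HermitianLatticeTree
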